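import Summits.CriticalPhenomena.CardyFormulaZ2.Theorems.CardyComplexConeParafermionToSLESixFamiliesDiamondDefs
import Mathlib.Analysis.Complex.CoveringMap
import Mathlib.Topology.Homotopy.Lifting
import HarnessLib

/-!
# Line `potential-darboux-picard-diamond`, stub S4 (`stub_identifyPotential`): the monotone argument of a convex trace

Helper file of the stub `stub_identifyPotential` of crux `ParafermionToSLESixFamilies` (stmt-CriticalPhenomena-11389).
Step (iii) of the identification feeds the boundary trace `t ↦ Φ(e^{it}) = G(R(e^{it}))` of the potential limit into
`DarbouxPicardConvex` / `TraceWindingNonneg` (S2), which want a CONTINUOUS NON-DECREASING ARGUMENT `θ` of `Φ(e^{it}) − w₀`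
with `θ(2π) = θ(0) + 2π`. The trace is known piecewise (S1 DIR/TURN in the limit): on consecutive parameter intervals
`[t_j, t_{j+1}]` the point moves weakly monotonically along a fixed direction `d_j`, consecutive directions turn LEFT by
`ε_j ∈ [0, π)` with `Σ ε_j = 2π`, and `w₀` lies strictly to the left of every piece line. This file proves, by elementary
angle bookkeeping (no winding numbers), that such a closed trace has the required argument:
`monotoneArg_of_pieces` (registered helper of the crux item). The continuous argument is the imaginary part of a lift of
`Φ − w₀` through `exp` (Mathlib's path lifting for the covering map `exp`); on each piece it differs from the principal
argument of `(Φ(t) − w₀)/(Φ(t_j) − w₀) ∈ {im ≥ 0} ∖ (−∞, 0]` by a constant (intermediate value theorem), whence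
monotonicity; the total increase is computed by telescoping the angles `arg (d_j / (Φ(t_j) − w₀)) ∈ (0, π)`.
-/

noncomputable section

namespace Summit.CriticalPhenomena.CardyFormulaZ2.Cruxes.ParafermionToSLESixFamilies.PotentialDarbouxPicardDiamond

open scoped Topology Real ComplexConjugate
open Filter Set Metric Complex

/-! ## Elementary angle bookkeeping -/

/-- Two real numbers with the same angle and distance `< 2π` are equal. -/
theorem eq_of_coe_angle_eq_of_abs_sub_lt {a b : ℝ} (h : (a : Real.Angle) = b) (hab : |a - b| < 2 * π) :
    a = b := by
  obtain ⟨k, hk⟩ := Real.Angle.angle_eq_iff_two_pi_dvd_sub.1 h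
  rw [hk, abs_mul, abs_of_pos Real.two_pi_pos] at hab
  have hk1 : |(k : ℝ)| < 1 := by
    by_contra hcon
    push Not at hcon
    have : 2 * π * 1 ≤ 2 * π * |(k : ℝ)| := mul_le_mul_of_nonneg_left hcon Real.two_pi_pos.le
    linarith
  have hk0 : k = 0 := by
    have : |k| < 1 := by exact_mod_cast hk1
    exact Int.abs_lt_one_iff.1 this
  rw [hk0, Int.cast_zero, mul_zero, sub_eq_zero] at hk
  exact hk

/-- The angle of `r · e^{iθ}` (`r > 0`) is `θ`. -/
theorem arg_coe_angle_of_polar {z : ℂ} {θ : ℝ} (hz : z ≠ 0) (h : z = (‖z‖ : ℂ) * exp (θ * I)) :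
    (arg z : Real.Angle) = θ := by
  have hr : 0 < ‖z‖ := norm_pos_iff.2 hz
  conv_lhs => rw [h]
  rw [arg_real_mul _ hr, arg_exp_mul_I, Real.Angle.coe_toIocMod]

/-- If `w₀` lies strictly to the left of the line through `P` with direction `d` (`0 < im ((w₀ − P) conj d)`), then so it
does for every point `P + r d` of that line. -/
theorem left_of_line_add {w₀ P d : ℂ} (h : 0 < ((w₀ - P) * conj d).im) (r : ℝ) :
    0 < ((w₀ - (P + r * d)) * conj d).im := by
  have h1 : (w₀ - (P + r * d)) * conj d = (w₀ - P) * conj d - r * (d * conj d) := by ring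
  rw [h1, mul_conj, ← ofReal_mul, sub_im, ofReal_im, sub_zero]
  exact h

/-- `w₀` strictly left of the line through `P` with direction `d` forces `P ≠ w₀`. -/
theorem ne_of_left_of_line {w₀ P d : ℂ} (h : 0 < ((w₀ - P) * conj d).im) : P ≠ w₀ := by
  rintro rfl
  simp at h

/-- `w₀` strictly left of the line through `P` with direction `d`: the quotient `d / (P − w₀)` has positive imaginary
part. -/
theorem div_im_pos_of_left_of_line {w₀ P d : ℂ} (h : 0 < ((w₀ - P) * conj d).im) : 0 < (d / (P - w₀)).im := by
  have hne : P - w₀ ≠ 0 := sub_ne_zero.2 (ne_of_left_of_line h)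
  have hns : 0 < normSq (P - w₀) := normSq_pos.2 hne
  have h1 : d / (P - w₀) = d * conj (P - w₀) * ((normSq (P - w₀))⁻¹ : ℝ) := by
    rw [div_eq_mul_inv, inv_def, mul_assoc]
  have h2 : (d * conj (P - w₀)).im = ((w₀ - P) * conj d).im := by
    have : d * conj (P - w₀) = -conj ((w₀ - P) * conj d) := by
      simp only [map_mul, map_sub, conj_conj]; ring
    rw [this, neg_im, conj_im, neg_neg]
  rw [h1, im_mul_ofReal, h2]
  exact mul_pos h (inv_pos.2 hns)

/-- The quotient `q = (u + r d)/u = 1 + r (d/u)` for `im (d/u) > 0`, `r ≥ 0`: it lies in the slit plane and its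
principal argument is in `[0, π)`. -/
theorem arg_one_add_mem {v : ℂ} (hv : 0 < v.im) {r : ℝ} (hr : 0 ≤ r) :
    (1 + r * v) ∈ slitPlane ∧ 0 ≤ arg (1 + r * v) ∧ arg (1 + r * v) < π := by
  have him : (1 + r * v).im = r * v.im := by simp
  rcases hr.eq_or_lt with rfl | hr'
  · simp only [ofReal_zero, zero_mul, add_zero, arg_one, le_refl, true_and, one_mem_slitPlane]
    exact Real.pi_pos
  · have hpos : 0 < (1 + r * v).im := by rw [him]; exact mul_pos hr' hv
    refine ⟨Or.inr hpos.ne', arg_nonneg_iff.2 hpos.le, arg_lt_pi_iff.2 (Or.inr hpos.ne')⟩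

/-! ## The monotone argument of a piecewise-monotone left-turning closed trace -/

/-- **Continuous non-decreasing argument with increase `2π`.** Let `γ` be continuous on `[0, 2π]` with `γ(2π) = γ(0)`,
and let `0 = t₀ ≤ t₁ ≤ ⋯ ≤ t_N = 2π`, nonzero directions `d_j` (`d_N = d₀`) turning LEFT by `ε_j ∈ [0, π)` from piece to
piece (`d_{j+1} = d_j e^{iε_j}`) with `Σ_{j<N} ε_j = 2π`; suppose that on each piece `[t_j, t_{j+1}]` the point `γ` moves
weakly monotonically along `d_j` (`γ s' − γ s ∈ ℝ≥0 · d_j` for `s ≤ s'`) and that `w₀` lies strictly to the LEFT of every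
piece line (`0 < im ((w₀ − γ t_j) · conj d_j)`). Then `γ − w₀` has a continuous non-decreasing argument `θ` on `[0, 2π]`
with `θ(2π) = θ(0) + 2π` — the boundary datum of `DarbouxPicardConvex` / `TraceWindingNonneg`. -/
theorem monotoneArg_of_pieces : ∀ (γ : ℝ → ℂ) (w₀ : ℂ) (N : ℕ) (t : ℕ → ℝ) (d : ℕ → ℂ) (ε : ℕ → ℝ), ContinuousOn γ (Icc 0 (2 * Real.pi)) → γ (2 * Real.pi) = γ 0 → t 0 = 0 → t N = 2 * Real.pi → (∀ j < N, t j ≤ t (j + 1)) → (∀ j ≤ N, d j ≠ 0) → d N = d 0 → (∀ j < N, 0 ≤ ε j ∧ ε j < Real.pi) → (∀ j < N, d (j + 1) = d j * exp (ε j * I)) → ∑ j ∈ Finset.range N, ε j = 2 * Real.pi → (∀ j < N, ∀ s s' : ℝ, t j ≤ s → s ≤ s' → s' ≤ t (j + 1) → ∃ r : ℝ, 0 ≤ r ∧ γ s' - γ s = r * d j) → (∀ j < N, 0 < ((w₀ - γ (t j)) * (starRingEnd ℂ) (d j)).im) → ∃ θ : ℝ → ℝ, ContinuousOn θ (Icc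 0 (2 * Real.pi)) ∧ MonotoneOn θ (Icc 0 (2 * Real.pi)) ∧ θ (2 * Real.pi) = θ 0 + 2 * Real.pi ∧ ∀ s ∈ Icc (0:ℝ) (2 * Real.pi), γ s ≠ w₀ ∧ γ s - w₀ = (‖γ s - w₀‖ : ℂ) * exp (θ s * I) := by
  intro γ w₀ N t d ε hγc hγper ht0 htN htmono hd hdN hε hturn hsum hmove hleft
  -- `N ≥ 1`
  have hN : 0 < N := by
    rcases Nat.eq_zero_or_pos N with h | h
    · exfalso; subst h; rw [Finset.sum_range_zero] at hsum; linarith [Real.pi_pos]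
    · exact h
  -- the partition is monotone and lies in `[0, 2π]`
  have htmono' : ∀ k i, i ≤ k → k ≤ N → t i ≤ t k := by
    intro k
    induction k with
    | zero => intro i hi _; rw [Nat.le_zero.1 hi]
    | succ k ih =>
      intro i hi hk
      rcases Nat.lt_or_ge i (k + 1) with h | h
      · exact (ih i (Nat.lt_succ_iff.1 h) (Nat.le_of_succ_le hk)).trans (htmono k hk)
      · rw [le_antisymm hi h]
  have htmem : ∀ j ≤ N, t j ∈ Icc 0 (2 * π) := fun j hj =>
    ⟨ht0 ▸ htmono' j 0 (Nat.zero_le j) hj, htN ▸ htmono' N j hj le_rfl⟩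
  -- every parameter lies in a piece
  have hpiece : ∀ s ∈ Icc 0 (2 * π), ∃ j < N, t j ≤ s ∧ s ≤ t (j + 1) := by
    intro s hs
    classical
    have hex : ∃ j, s ≤ t (j + 1) := ⟨N - 1, by rw [Nat.sub_add_cancel hN, htN]; exact hs.2⟩
    refine ⟨Nat.find hex, ?_, ?_, Nat.find_spec hex⟩
    · by_contra hcon
      have hmin := Nat.find_min hex (m := N - 1) (by omega)
      rw [Nat.sub_add_cancel hN, htN] at hmin
      exact hmin hs.2
    · rcases h0 : Nat.find hex with _ | k
      · rw [ht0]; exact hs.1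
      · have hmin := Nat.find_min hex (m := k) (by omega)
        exact (not_le.1 hmin).le
  -- `w₀` is strictly left of every piece line at every point of the piece; in particular `γ ≠ w₀`
  have hleft' : ∀ j < N, ∀ s, t j ≤ s → s ≤ t (j + 1) → 0 < ((w₀ - γ s) * conj (d j)).im := by
    intro j hj s h1 h2
    obtain ⟨r, -, hrs⟩ := hmove j hj (t j) s le_rfl h1 h2
    have : γ s = γ (t j) + r * d j := by rw [← hrs]; ring
    rw [this]
    exact left_of_line_add (hleft j hj) r
  have hne : ∀ s ∈ Icc 0 (2 * π), γ s ≠ w₀ := by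
    intro s hs
    obtain ⟨j, hj, h1, h2⟩ := hpiece s hs
    exact ne_of_left_of_line (hleft' j hj s h1 h2)
  -- the lift of `γ − w₀` through `exp`
  set f : ℝ → ℂ := fun s => γ s - w₀ with hf
  have hfc : ContinuousOn f (Icc 0 (2 * π)) := hγc.sub continuousOn_const
  have hfne : ∀ s ∈ Icc 0 (2 * π), f s ≠ 0 := fun s hs => sub_ne_zero.2 (hne s hs)
  have hmemI : ∀ σ : unitInterval, 2 * π * (σ : ℝ) ∈ Icc 0 (2 * π) := fun σ =>
    ⟨mul_nonneg Real.two_pi_pos.le σ.2.1, mul_le_of_le_one_right Real.two_pi_pos.le σ.2.2⟩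
  have hgc : Continuous fun σ : unitInterval => f (2 * π * σ) :=
    hfc.comp_continuous (continuous_const.mul continuous_subtype_val) hmemI
  set g : C(unitInterval, {z : ℂ // z ≠ 0}) :=
    ⟨fun σ => ⟨f (2 * π * σ), hfne _ (hmemI σ)⟩, hgc.subtype_mk _⟩ with hg
  have h0mem : (0 : ℝ) ∈ Icc 0 (2 * π) := ⟨le_rfl, Real.two_pi_pos.le⟩
  have hg0 : g 0 = ⟨exp (log (f 0)), exp_ne_zero _⟩ := by
    ext
    change f (2 * π * (0 : unitInterval)) = exp (log (f 0))
    rw [exp_log (hfne 0 h0mem)]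
    simp
  obtain ⟨Γ, hΓ, -⟩ := Complex.isCoveringMap_exp.exists_path_lifts g (log (f 0)) hg0
  have hexp : ∀ σ : unitInterval, exp (Γ σ) = f (2 * π * σ) := fun σ => by
    have := congrArg (fun h : unitInterval → {z : ℂ // z ≠ 0} => ((h σ : {z : ℂ // z ≠ 0}) : ℂ)) hΓ
    exact this
  -- the continuous argument
  set θ : ℝ → ℝ := fun s => (Γ (projIcc (0 : ℝ) 1 zero_le_one (s / (2 * π)))).im with hθ
  have hθc : Continuous θ :=
    continuous_im.comp (Γ.continuous.comp (continuous_projIcc.comp (continuous_id.div_const _)))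
  have hpolar : ∀ s ∈ Icc 0 (2 * π), f s = (‖f s‖ : ℂ) * exp (θ s * I) := by
    intro s hs
    have hσ : s / (2 * π) ∈ Icc (0 : ℝ) 1 :=
      ⟨div_nonneg hs.1 Real.two_pi_pos.le, div_le_one_of_le₀ hs.2 Real.two_pi_pos.le⟩
    have hproj : projIcc 0 1 zero_le_one (s / (2 * π)) = ⟨s / (2 * π), hσ⟩ := projIcc_of_mem _ hσ
    have h1 : exp (Γ ⟨s / (2 * π), hσ⟩) = f s := by
      rw [hexp]
      change f (2 * π * (s / (2 * π))) = f s
      rw [mul_div_cancel₀ _ Real.two_pi_pos.ne']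
    have hθs : θ s = (Γ ⟨s / (2 * π), hσ⟩).im := by simp only [hθ, hproj]
    rw [hθs, ← h1, norm_exp, ofReal_exp, exp_mul_I, ← exp_eq_exp_re_mul_sin_add_cos]
  have hang : ∀ s ∈ Icc 0 (2 * π), (arg (f s) : Real.Angle) = θ s := fun s hs =>
    arg_coe_angle_of_polar (hfne s hs) (hpolar s hs)
  -- on a piece, `θ − θ(t_j)` is the principal argument of `f / f(t_j)`
  have hquot : ∀ j < N, ∀ s s', t j ≤ s → s ≤ s' → s' ≤ t (j + 1) →
      f s' / f s ∈ slitPlane ∧ 0 ≤ arg (f s' / f s) ∧ arg (f s' / f s) < π := by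
    intro j hj s s' h1 h2 h3
    obtain ⟨r, hr, hrs⟩ := hmove j hj s s' h1 h2 h3
    have hl := hleft' j hj s h1 (h2.trans h3)
    have hfs : f s ≠ 0 := sub_ne_zero.2 (ne_of_left_of_line hl)
    have hq : f s' / f s = 1 + r * (d j / (γ s - w₀)) := by
      have : f s' = f s + r * d j := by simp only [hf]; rw [← hrs]; ring
      rw [this, add_div, div_self hfs, mul_div_assoc]
    rw [hq]
    exact arg_one_add_mem (div_im_pos_of_left_of_line hl) hr
  have hpieceArg : ∀ j < N, ∀ s, t j ≤ s → s ≤ t (j + 1) → θ s = θ (t j) + arg (f s / f (t j)) := by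
    intro j hj s h1 h2
    have htj : t j ∈ Icc 0 (2 * π) := htmem j hj.le
    have htj1 : t (j + 1) ∈ Icc 0 (2 * π) := htmem (j + 1) hj
    have hmemS : ∀ x, t j ≤ x → x ≤ t (j + 1) → x ∈ Icc 0 (2 * π) := fun x hx1 hx2 =>
      ⟨htj.1.trans hx1, hx2.trans htj1.2⟩
    -- the defect `h = θ − θ(t_j) − arg (f/f(t_j))` is continuous, `2πℤ`-valued and vanishes at `t_j`
    set h : ℝ → ℝ := fun x => θ x - θ (t j) - arg (f x / f (t j)) with hh
    have hftj : f (t j) ≠ 0 := hfne _ htj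
    have hcont : ContinuousOn h (Icc (t j) (t (j + 1))) := by
      refine (hθc.continuousOn.sub continuousOn_const).sub ?_
      intro x hx
      have hsl := (hquot j hj (t j) x le_rfl hx.1 hx.2).1
      have hq : ContinuousWithinAt (fun x => f x / f (t j)) (Icc (t j) (t (j + 1))) x :=
        ((hfc x (hmemS x hx.1 hx.2)).mono fun y hy => hmemS y hy.1 hy.2).div_const _
      exact ContinuousAt.comp_continuousWithinAt_of_eq (f := fun y => f y / f (t j)) (g := arg)
        (continuousAt_arg hsl) hq rfl
    have hval : ∀ x ∈ Icc (t j) (t (j + 1)), ∃ k : ℤ, h x = 2 * π * k := by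
      intro x hx
      have hx' := hmemS x hx.1 hx.2
      have h1 : ((θ x - θ (t j) : ℝ) : Real.Angle) = arg (f x / f (t j)) := by
        rw [Real.Angle.coe_sub, ← hang x hx', ← hang (t j) htj, arg_div_coe_angle (hfne x hx') hftj]
      obtain ⟨k, hk⟩ := Real.Angle.angle_eq_iff_two_pi_dvd_sub.1 h1
      exact ⟨k, hk⟩
    have hzero : h (t j) = 0 := by
      simp only [hh, div_self hftj, arg_one, sub_self]
    have hall : ∀ x ∈ Icc (t j) (t (j + 1)), h x = 0 := by
      intro x hx
      by_contra hx0
      obtain ⟨k, hk⟩ := hval x hx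
      have hk0 : k ≠ 0 := by rintro rfl; simp at hk; exact hx0 hk
      -- `|h x| ≥ 2π`, so by the intermediate value theorem `h` takes the value `±π ∉ 2πℤ` on `[t_j, x]`
      have hcx : ContinuousOn h (Icc (t j) x) := hcont.mono (Icc_subset_Icc_right hx.2)
      rcases lt_or_gt_of_ne hk0 with hneg | hpos
      · have hle : h x ≤ -(2 * π) := by
          rw [hk]; have : (k : ℝ) ≤ -1 := by exact_mod_cast Int.le_sub_one_of_lt hneg
          nlinarith [Real.pi_pos]
        have hmem : -π ∈ Icc (h x) (h (t j)) := ⟨by linarith [Real.pi_pos], by rw [hzero]; linarith [Real.pi_pos]⟩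
        obtain ⟨y, hy, hyv⟩ := intermediate_value_Icc' hx.1 hcx hmem
        obtain ⟨m, hm⟩ := hval y ⟨hy.1, hy.2.trans hx.2⟩
        rw [hyv] at hm
        have : (m : ℝ) = -1 / 2 := by field_simp at hm ⊢; linarith
        have h2 : (2 * m : ℤ) = -1 := by exact_mod_cast (by rw [this]; ring : (2 : ℝ) * m = -1)
        omega
      · have hle : 2 * π ≤ h x := by
          rw [hk]; have : (1 : ℝ) ≤ k := by exact_mod_cast hpos
          nlinarith [Real.pi_pos]
        have hmem : π ∈ Icc (h (t j)) (h x) := ⟨by rw [hzero]; linarith [Real.pi_pos], by linarith [Real.pi_pos]⟩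
        obtain ⟨y, hy, hyv⟩ := intermediate_value_Icc hx.1 hcx hmem
        obtain ⟨m, hm⟩ := hval y ⟨hy.1, hy.2.trans hx.2⟩
        rw [hyv] at hm
        have : (m : ℝ) = 1 / 2 := by field_simp at hm ⊢; linarith
        have h2 : (2 * m : ℤ) = 1 := by exact_mod_cast (by rw [this]; ring : (2 : ℝ) * m = 1)
        omega
    have := hall s ⟨h1, h2⟩
    simp only [hh] at this
    linarith
  -- monotone on each piece
  have hmonoPiece : ∀ j < N, ∀ s s', t j ≤ s → s ≤ s' → s' ≤ t (j + 1) → θ s ≤ θ s' := by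
    intro j hj s s' h1 h2 h3
    have hs := hpieceArg j hj s h1 (h2.trans h3)
    have hs' := hpieceArg j hj s' (h1.trans h2) h3
    have hqs := hquot j hj (t j) s le_rfl h1 (h2.trans h3)
    have hqs' := hquot j hj (t j) s' le_rfl (h1.trans h2) h3
    have hq := hquot j hj s s' h1 h2 h3
    have htj : t j ∈ Icc 0 (2 * π) := htmem j hj.le
    have htj1 : t (j + 1) ∈ Icc 0 (2 * π) := htmem (j + 1) hj
    have hsm : s ∈ Icc 0 (2 * π) := ⟨htj.1.trans h1, (h2.trans h3).trans htj1.2⟩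
    have hsm' : s' ∈ Icc 0 (2 * π) := ⟨htj.1.trans (h1.trans h2), h3.trans htj1.2⟩
    -- `θ s' − θ s` is within `π` of `0` and has the angle of `arg (f s'/f s) ∈ [0, π)`
    have h1' : ((θ s' - θ s : ℝ) : Real.Angle) = arg (f s' / f s) := by
      rw [Real.Angle.coe_sub, ← hang s' hsm', ← hang s hsm, arg_div_coe_angle (hfne s' hsm') (hfne s hsm)]
    have habs : |θ s' - θ s - arg (f s' / f s)| < 2 * π := by
      rw [abs_lt]; constructor <;> linarith
    have := eq_of_coe_angle_eq_of_abs_sub_lt h1' habs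
    linarith
  -- monotone on the knots
  have hmonoKnots : ∀ k i, i ≤ k → k ≤ N → θ (t i) ≤ θ (t k) := by
    intro k
    induction k with
    | zero => intro i hi _; rw [Nat.le_zero.1 hi]
    | succ k ih =>
      intro i hi hk
      rcases Nat.lt_or_ge i (k + 1) with h | h
      · exact (ih i (Nat.lt_succ_iff.1 h) (Nat.le_of_succ_le hk)).trans
          (hmonoPiece k hk (t k) (t (k + 1)) le_rfl (htmono k hk) le_rfl)
      · rw [le_antisymm hi h]
  refine ⟨θ, hθc.continuousOn, ?_, ?_, fun s hs => ⟨hne s hs, hpolar s hs⟩⟩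
  · -- monotone on `[0, 2π]`
    intro s hs s' hs' hss'
    obtain ⟨j, hj, h1, h2⟩ := hpiece s hs
    obtain ⟨j', hj', h1', h2'⟩ := hpiece s' hs'
    rcases lt_trichotomy j j' with hlt | rfl | hgt
    · calc θ s ≤ θ (t (j + 1)) := hmonoPiece j hj s _ h1 h2 le_rfl
        _ ≤ θ (t j') := hmonoKnots j' (j + 1) hlt hj'.le
        _ ≤ θ s' := hmonoPiece j' hj' (t j') s' le_rfl h1' h2'
    · exact hmonoPiece j hj s s' h1 hss' h2'
    · have : s' ≤ s := h2'.trans ((htmono' j (j' + 1) hgt hj.le).trans h1)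
      rw [le_antisymm hss' this]
  · -- total increase `2π`: telescoping the angles `φ_j = arg (d_j / f (t_j)) ∈ (0, π)`
    have hsumθ : θ (2 * π) - θ 0 = ∑ j ∈ Finset.range N, (θ (t (j + 1)) - θ (t j)) := by
      rw [Finset.sum_range_sub (fun j => θ (t j)), htN, ht0]
    set φ : ℕ → ℝ := fun j => arg (d j / f (t j)) with hφ
    have hφmem : ∀ j ≤ N, 0 < φ j ∧ φ j < π := by
      intro j hj
      have hl : 0 < ((w₀ - γ (t j)) * conj (d j)).im := by
        rcases hj.lt_or_eq with hj' | rfl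
        · exact hleft j hj'
        · have h0 := hleft 0 hN
          rw [ht0] at h0
          rwa [htN, hγper, hdN]
      have hv := div_im_pos_of_left_of_line hl
      refine ⟨?_, ?_⟩
      · rcases (arg_nonneg_iff.2 hv.le).lt_or_eq with h | h
        · exact h
        · exfalso; have := arg_eq_zero_iff.1 h.symm; exact hv.ne' this.2
      · exact (arg_le_pi _).lt_of_ne fun h => by have := arg_eq_pi_iff.1 h; exact hv.ne' this.2
    -- the recursion `φ (j+1) = φ j − α j + ε j`
    have hstep : ∀ j < N, φ (j + 1) = φ j - (θ (t (j + 1)) - θ (t j)) + ε j := by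
      intro j hj
      have htj : t j ∈ Icc 0 (2 * π) := htmem j hj.le
      have htj1 : t (j + 1) ∈ Icc 0 (2 * π) := htmem (j + 1) hj
      have hα := hpieceArg j hj (t (j + 1)) (htmono j hj) le_rfl
      have hq := hquot j hj (t j) (t (j + 1)) le_rfl (htmono j hj) le_rfl
      have hdj : d j ≠ 0 := hd j hj.le
      have hdj1 : d (j + 1) ≠ 0 := hd (j + 1) hj
      have hf0 : f (t j) ≠ 0 := hfne _ htj
      have hf1 : f (t (j + 1)) ≠ 0 := hfne _ htj1
      -- angle identity
      have hA : ((φ (j + 1) : ℝ) : Real.Angle) = ((φ j - (θ (t (j + 1)) - θ (t j)) + ε j : ℝ) : Real.Angle) := by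
        have e1 : ((φ (j + 1) : ℝ) : Real.Angle) = (arg (d (j + 1)) : Real.Angle) - arg (f (t (j + 1))) := by
          simp only [hφ]; rw [arg_div_coe_angle hdj1 hf1]
        have e2 : ((φ j : ℝ) : Real.Angle) = (arg (d j) : Real.Angle) - arg (f (t j)) := by
          simp only [hφ]; rw [arg_div_coe_angle hdj hf0]
        have e3 : ((θ (t (j + 1)) - θ (t j) : ℝ) : Real.Angle) = (arg (f (t (j + 1))) : Real.Angle) - arg (f (t j)) := by
          rw [Real.Angle.coe_sub, ← hang _ htj1, ← hang _ htj]
        have e4 : (arg (d (j + 1)) : Real.Angle) = arg (d j) + (ε j : Real.Angle) := by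
          rw [hturn j hj, arg_mul_coe_angle hdj (exp_ne_zero _), arg_exp_mul_I, Real.Angle.coe_toIocMod]
        rw [Real.Angle.coe_add, Real.Angle.coe_sub, e1, e2, e3, e4]
        abel
      have hb1 := hφmem (j + 1) hj
      have hb0 := hφmem j hj.le
      have hεj := hε j hj
      have habs : |φ (j + 1) - (φ j - (θ (t (j + 1)) - θ (t j)) + ε j)| < 2 * π := by
        rw [hα, add_sub_cancel_left, abs_lt]
        constructor <;> linarith [hq.2.1, hq.2.2]
      exact eq_of_coe_angle_eq_of_abs_sub_lt hA habs
    have hφN : φ N = φ 0 := by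
      simp only [hφ, hf]; rw [hdN, htN, hγper, ht0]
    have htel : ∑ j ∈ Finset.range N, (φ (j + 1) - φ j) = 0 := by
      rw [Finset.sum_range_sub, hφN, sub_self]
    have hrw : ∑ j ∈ Finset.range N, (φ (j + 1) - φ j) =
        ∑ j ∈ Finset.range N, ε j - ∑ j ∈ Finset.range N, (θ (t (j + 1)) - θ (t j)) := by
      rw [← Finset.sum_sub_distrib]
      refine Finset.sum_congr rfl fun j hj => ?_
      rw [hstep j (Finset.mem_range.1 hj)]
      ring
    rw [hrw, hsum, ← hsumθ] at htel
    linarith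

end Summit.CriticalPhenomena.CardyFormulaZ2.Cruxes.ParafermionToSLESixFamilies.PotentialDarbouxPicardDiamond

end
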